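import Summits.QuantumFields.YangMills.Theorems.NPointIsotropy.Negative.TieLoadBearing
import Summits.QuantumFields.YangMills.Theorems.NPointIsotropy.Negative.NPointRegularJunk
import Summits.QuantumFields.YangMills.Theorems.CurvatureBoostCovariance.Negative.Unbundled
import Summits.QuantumFields.YangMills.Theorems.PencilRigidityNPointIsotropyMopup

/-!
# `PencilRigidity.NPointIsotropy`, line `quarter-turn-corner-operator`: stub E `stub_eighthTurnPropagation`

Stub E of the lead-1 skeleton `Cruxes/NPointIsotropy/Lines/quarter-turn-corner-operator.lean` of crux
`stmt-QuantumFields-11686` (`Summit.QuantumFields.YangMills.Theses.PencilRigidity.NPointIsotropy`), proved in the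
registered text: **the eighth-turn identity propagates to `R_{π/4}`-invariance on `⁰𝒮`.**

Informal statement. Let `S₁` be a one-species Schwinger family on `ℝ⁴`, translation invariant on `⁰𝒮`
(`Translations S₁`), with every `𝔖ₙ|⁰𝒮` integration against a function (`NPointRegular S₁`), and suppose the
eighth-turn identity: for the quarter-turn `Rq` (`e₀ ↦ e₁ ↦ -e₀`) and the eighth-turn `R₈` (rotation by `π/4` of the
`(x₀,x₁)`-plane) and all off-diagonal `G₁` (`m` points), `G₂` (`n` points) supported in the quadrant
`Q = {x⁰ > 0 > x¹}` (all points), `𝔖ₘ₊ₙ(Θ(R₈G₁)* ⊗ R₈G₂) = 𝔖ₘ₊ₙ(ΘG₁* ⊗ RqG₂)`. Then `𝔖ₙ(R₈·F) = 𝔖ₙ(F)` for every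
`n` and every `F ∈ ⁰𝒮ₙ`. (The remaining hypotheses of the registered text — OS package, hypercubic invariance,
ordered and unordered E2 in the eight planar frames, the planar spectral cone — are carried but not used.)

Proof. (1) Algebra (`Propagation.osAdjoint_linActMulti_osAdjoint`): `θ R₈ θ = R₈⁻¹` for the time reflection `θ`
(coordinates, `Propagation.apply_coord`, `Propagation.rot_theta_rot_theta`), hence `Θ(R₈·ΘA*)* = R₈⁻¹·A` for every
`A`; and `R₈² = Rq` is a quarter-turn (`Propagation.quarterTurn_trans`), which is fed to the hypothesis.
(2) The vacuum slot `n = 0` of the identity (`G₂ = 1` the empty tensor, `G₁ = ΘA*`): for every off-diagonal `A`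
supported in the negative quadrant `{x⁰ < 0, x¹ < 0}` (all `m` points), `𝔖ₘ(R₈⁻¹·A) = 𝔖ₘ(A)` — in operator language
`⟨A^{1/2}[G₁], Ω⟩ = ⟨[G₁], AΩ⟩ = ⟨[G₁], Ω⟩`. (3) Transport (`Propagation.apply_linActMulti_symm_eq_of_identity`): a
compactly supported `F` is translated into the negative quadrant (`Propagation.exists_translate_neg`), and
`R₈⁻¹·(F(· - a)) = (R₈⁻¹·F)(· - R₈⁻¹a)`, so translation invariance on `⁰𝒮` gives `𝔖ₘ(R₈⁻¹·F) = 𝔖ₘ(F)` for every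
compactly supported `F` whose support avoids the coincidence locus. (4) Mop-up: with `NPointRegular` the landed a.e.
exhaustion `Mopup.apply_linActMulti_eq_of_generic` (change of variables under the diagonal action, smooth compactly
supported exhaustion of a conull open set off the coincidence locus, dominated convergence) extends this to all of
`⁰𝒮ₘ`; finally `𝔖ₘ(F) = 𝔖ₘ(R₈⁻¹·(R₈·F)) = 𝔖ₘ(R₈·F)`.

Remark for the line. The proof uses only the degenerate slot `n = 0` of the identity hypothesis (stub D), which is
`R₈`-invariance of `𝔖ₘ` on quadrant-supported tests in disguise; the corner-split slots `m, n ≥ 1` and the planar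
cone are not needed for stub E as registered.

References: folklore (change of variables as in K. Osterwalder, R. Schrader, Comm. Math. Phys. 31 (1973) §4.2).
Design: no `def`; helpers in the sub-namespace `Propagation`; the statement of `stub_eighthTurnPropagation` is the
registered one byte-for-byte. The file does not remove Mathlib's `SimplexCategory` instance `Fintype (Fin (x.len + 1))`:
the statement elaborated here is accepted verbatim (`exact stub_eighthTurnPropagation`, checked) in the skeleton's
context, where that instance is removed.
-/

noncomputable section

namespace Summit.QuantumFields.YangMills.Theorems.NPointIsotropy.QuarterTurnCornerOperator

open scoped BigOperators SchwartzMap ComplexConjugate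
open MeasureTheory Filter Topology
open Literature.MathematicalPhysics.QuantumLattice Literature.MathematicalPhysics.AQFT
  Literature.MathematicalPhysics.QuantumFieldTheory
open Summit.QuantumFields.YangMills.Theorems.NPointIsotropy.Negative (E4 NPointRegular)
open Summit.QuantumFields.YangMills.Theorems.CurvatureBoostCovariance.Negative
  (OSPackage Translations Hypercubic EightFrameRP isOffDiagonal_linActMulti)

namespace Propagation

/-- Coordinates of the time reflection `θ` of `ℝ⁴`. [folklore] -/
theorem theta_coord (y : E4) :
    timeReflection 4 y 0 = -y 0 ∧ timeReflection 4 y 1 = y 1 ∧ timeReflection 4 y 2 = y 2 ∧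
      timeReflection 4 y 3 = y 3 := by
  simp [timeReflection_apply]

/-- Coordinates of a linear isometry of `ℝ⁴` acting on the `(x₀,x₁)`-plane by the matrix `(a, -b; b, a)` and
fixing `e₂, e₃`. [folklore] -/
theorem apply_coord (R : E4 ≃ₗᵢ[ℝ] E4) {a b : ℝ}
    (h0 : R (EuclideanSpace.single 0 1) = a • EuclideanSpace.single 0 1 + b • EuclideanSpace.single 1 1)
    (h1 : R (EuclideanSpace.single 1 1) = -(b • EuclideanSpace.single 0 1) + a • EuclideanSpace.single 1 1)
    (h2 : R (EuclideanSpace.single 2 1) = EuclideanSpace.single 2 1)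
    (h3 : R (EuclideanSpace.single 3 1) = EuclideanSpace.single 3 1) (x : E4) :
    R x 0 = a * x 0 - b * x 1 ∧ R x 1 = b * x 0 + a * x 1 ∧ R x 2 = x 2 ∧ R x 3 = x 3 := by
  have hx : x = ∑ i, x i • EuclideanSpace.single i (1 : ℝ) := by
    simpa using ((EuclideanSpace.basisFun (Fin 4) ℝ).sum_repr x).symm
  have hR : R x = ∑ i, x i • R (EuclideanSpace.single i 1) := by
    conv_lhs => rw [hx]
    simp [map_sum]
  rw [hR]
  simp [Fin.sum_univ_four, h0, h1, h2, h3]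
  exact ⟨by ring, by ring⟩

/-- For a rotation `R` of the `(x₀,x₁)`-plane (fixing `e₂, e₃`) and the time reflection `θ`: `R θ R θ = 1`,
i.e. `θ R θ = R⁻¹`. [folklore] -/
theorem rot_theta_rot_theta (R : E4 ≃ₗᵢ[ℝ] E4) {a b : ℝ}
    (h0 : R (EuclideanSpace.single 0 1) = a • EuclideanSpace.single 0 1 + b • EuclideanSpace.single 1 1)
    (h1 : R (EuclideanSpace.single 1 1) = -(b • EuclideanSpace.single 0 1) + a • EuclideanSpace.single 1 1)
    (h2 : R (EuclideanSpace.single 2 1) = EuclideanSpace.single 2 1)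
    (h3 : R (EuclideanSpace.single 3 1) = EuclideanSpace.single 3 1) (hab : a ^ 2 + b ^ 2 = 1) (u : E4) :
    R (timeReflection 4 (R (timeReflection 4 u))) = u := by
  obtain ⟨c0, c1, c2, c3⟩ := apply_coord R h0 h1 h2 h3 (timeReflection 4 (R (timeReflection 4 u)))
  obtain ⟨t0, t1, t2, t3⟩ := theta_coord (R (timeReflection 4 u))
  obtain ⟨d0, d1, d2, d3⟩ := apply_coord R h0 h1 h2 h3 (timeReflection 4 u)
  obtain ⟨s0, s1, s2, s3⟩ := theta_coord u
  have e0 : R (timeReflection 4 (R (timeReflection 4 u))) 0 = u 0 := by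
    rw [c0, t0, t1, d0, d1, s0, s1]
    linear_combination u 0 * hab
  have e1 : R (timeReflection 4 (R (timeReflection 4 u))) 1 = u 1 := by
    rw [c1, t0, t1, d0, d1, s0, s1]
    linear_combination u 1 * hab
  have e2 : R (timeReflection 4 (R (timeReflection 4 u))) 2 = u 2 := by rw [c2, t2, d2, s2]
  have e3 : R (timeReflection 4 (R (timeReflection 4 u))) 3 = u 3 := by rw [c3, t3, d3, s3]
  ext i
  fin_cases i
  exacts [e0, e1, e2, e3]

/-- `θ R⁻¹ θ = R` for a rotation `R` of the `(x₀,x₁)`-plane fixing `e₂, e₃`. [folklore] -/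
theorem theta_symm_theta (R : E4 ≃ₗᵢ[ℝ] E4) {a b : ℝ}
    (h0 : R (EuclideanSpace.single 0 1) = a • EuclideanSpace.single 0 1 + b • EuclideanSpace.single 1 1)
    (h1 : R (EuclideanSpace.single 1 1) = -(b • EuclideanSpace.single 0 1) + a • EuclideanSpace.single 1 1)
    (h2 : R (EuclideanSpace.single 2 1) = EuclideanSpace.single 2 1)
    (h3 : R (EuclideanSpace.single 3 1) = EuclideanSpace.single 3 1) (hab : a ^ 2 + b ^ 2 = 1) (v : E4) :
    timeReflection 4 (R.symm (timeReflection 4 v)) = R v := by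
  have h := rot_theta_rot_theta R h0 h1 h2 h3 hab (timeReflection 4 (R.symm (timeReflection 4 v)))
  rw [timeReflection_timeReflection, LinearIsometryEquiv.apply_symm_apply,
    timeReflection_timeReflection] at h
  exact h.symm

/-- **`Θ(R·G)* = R⁻¹·(ΘG)*`** in the form used below: for a rotation `R` of the `(x₀,x₁)`-plane fixing `e₂, e₃`
and any `A`, `osAdjoint (linActMulti R (osAdjoint A)) = linActMulti R⁻¹ A`. [folklore] -/
theorem osAdjoint_linActMulti_osAdjoint {m : ℕ} (R : E4 ≃ₗᵢ[ℝ] E4) {a b : ℝ}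
    (h0 : R (EuclideanSpace.single 0 1) = a • EuclideanSpace.single 0 1 + b • EuclideanSpace.single 1 1)
    (h1 : R (EuclideanSpace.single 1 1) = -(b • EuclideanSpace.single 0 1) + a • EuclideanSpace.single 1 1)
    (h2 : R (EuclideanSpace.single 2 1) = EuclideanSpace.single 2 1)
    (h3 : R (EuclideanSpace.single 3 1) = EuclideanSpace.single 3 1) (hab : a ^ 2 + b ^ 2 = 1)
    (A : 𝓢((Fin m → E4), ℂ)) :
    osAdjoint (linActMulti R (osAdjoint A)) = linActMulti R.symm A := by
  ext z
  simp only [osAdjoint_apply, linActMulti_apply, Fin.rev_rev, theta_symm_theta R h0 h1 h2 h3 hab,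
    Complex.conj_conj, LinearIsometryEquiv.symm_symm]

/-- `R⁻¹·(R·F) = F`. [folklore] -/
theorem linActMulti_symm_linActMulti {m : ℕ} (R : E4 ≃ₗᵢ[ℝ] E4) (F : 𝓢((Fin m → E4), ℂ)) :
    linActMulti R.symm (linActMulti R F) = F := by
  ext x
  simp [linActMulti_apply]

/-- The square of the eighth-turn is the quarter-turn `e₀ ↦ e₁ ↦ -e₀` (coordinates). [folklore] -/
theorem trans_apply_coord (R : E4 ≃ₗᵢ[ℝ] E4)
    (h0 : R (EuclideanSpace.single 0 1) =
      (Real.sqrt 2 / 2) • EuclideanSpace.single 0 1 + (Real.sqrt 2 / 2) • EuclideanSpace.single 1 1)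
    (h1 : R (EuclideanSpace.single 1 1) =
      -((Real.sqrt 2 / 2) • EuclideanSpace.single 0 1) + (Real.sqrt 2 / 2) • EuclideanSpace.single 1 1)
    (h2 : R (EuclideanSpace.single 2 1) = EuclideanSpace.single 2 1)
    (h3 : R (EuclideanSpace.single 3 1) = EuclideanSpace.single 3 1) (x : E4) :
    (R.trans R) x 0 = -x 1 ∧ (R.trans R) x 1 = x 0 ∧ (R.trans R) x 2 = x 2 ∧ (R.trans R) x 3 = x 3 := by
  have hc : Real.sqrt 2 / 2 * (Real.sqrt 2 / 2) = 1 / 2 := by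
    have h := Real.mul_self_sqrt (zero_le_two (α := ℝ))
    linear_combination h / 4
  obtain ⟨c0, c1, c2, c3⟩ := apply_coord R h0 h1 h2 h3 (R x)
  obtain ⟨d0, d1, d2, d3⟩ := apply_coord R h0 h1 h2 h3 x
  rw [LinearIsometryEquiv.trans_apply]
  refine ⟨?_, ?_, ?_, ?_⟩
  · rw [c0, d0, d1]
    linear_combination (-(2 : ℝ) * x 1) * hc
  · rw [c1, d0, d1]
    linear_combination ((2 : ℝ) * x 0) * hc
  · rw [c2, d2]
  · rw [c3, d3]

/-- The square of the eighth-turn `R` is a quarter-turn: `R² e₀ = e₁`, `R² e₁ = -e₀`, `R² e₂ = e₂`, `R² e₃ = e₃`.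
[folklore] -/
theorem quarterTurn_trans (R : E4 ≃ₗᵢ[ℝ] E4)
    (h0 : R (EuclideanSpace.single 0 1) =
      (Real.sqrt 2 / 2) • EuclideanSpace.single 0 1 + (Real.sqrt 2 / 2) • EuclideanSpace.single 1 1)
    (h1 : R (EuclideanSpace.single 1 1) =
      -((Real.sqrt 2 / 2) • EuclideanSpace.single 0 1) + (Real.sqrt 2 / 2) • EuclideanSpace.single 1 1)
    (h2 : R (EuclideanSpace.single 2 1) = EuclideanSpace.single 2 1)
    (h3 : R (EuclideanSpace.single 3 1) = EuclideanSpace.single 3 1) :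
    (R.trans R) (EuclideanSpace.single 0 1) = EuclideanSpace.single 1 1 ∧
      (R.trans R) (EuclideanSpace.single 1 1) = -EuclideanSpace.single 0 1 ∧
      (R.trans R) (EuclideanSpace.single 2 1) = EuclideanSpace.single 2 1 ∧
      (R.trans R) (EuclideanSpace.single 3 1) = EuclideanSpace.single 3 1 := by
  have key : ∀ (j : Fin 4) (y : E4), (R.trans R) (EuclideanSpace.single j 1) 0 = y 0 →
      (R.trans R) (EuclideanSpace.single j 1) 1 = y 1 → (R.trans R) (EuclideanSpace.single j 1) 2 = y 2 →
      (R.trans R) (EuclideanSpace.single j 1) 3 = y 3 → (R.trans R) (EuclideanSpace.single j 1) = y := by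
    intro j y e0 e1 e2 e3
    ext i
    fin_cases i
    exacts [e0, e1, e2, e3]
  refine ⟨?_, ?_, ?_, ?_⟩
  · obtain ⟨c0, c1, c2, c3⟩ := trans_apply_coord R h0 h1 h2 h3 (EuclideanSpace.single 0 1)
    exact key 0 _ (by simpa using c0) (by simpa using c1) (by simpa using c2) (by simpa using c3)
  · obtain ⟨c0, c1, c2, c3⟩ := trans_apply_coord R h0 h1 h2 h3 (EuclideanSpace.single 1 1)
    exact key 1 _ (by simpa using c0) (by simpa using c1) (by simpa using c2) (by simpa using c3)
  · obtain ⟨c0, c1, c2, c3⟩ := trans_apply_coord R h0 h1 h2 h3 (EuclideanSpace.single 2 1)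
    exact key 2 _ (by simpa using c0) (by simpa using c1) (by simpa using c2) (by simpa using c3)
  · obtain ⟨c0, c1, c2, c3⟩ := trans_apply_coord R h0 h1 h2 h3 (EuclideanSpace.single 3 1)
    exact key 3 _ (by simpa using c0) (by simpa using c1) (by simpa using c2) (by simpa using c3)

/-- The eighth-turn has `a² + b² = 1` with `a = b = √2/2`. [folklore] -/
theorem sqrt_two_half_sq : (Real.sqrt 2 / 2) ^ 2 + (Real.sqrt 2 / 2) ^ 2 = 1 := by
  have h := Real.mul_self_sqrt (zero_le_two (α := ℝ))
  linear_combination h / 2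

/-- A compact set of configurations is moved into the open negative quadrant `{x⁰ < 0, x¹ < 0}` (all points) by a
translation. [folklore] -/
theorem exists_translate_neg {m : ℕ} {K : Set (Fin m → E4)} (hK : IsCompact K) :
    ∃ a : E4, ∀ x : Fin m → E4, (fun i => x i - a) ∈ K → ∀ i, x i 0 < 0 ∧ x i 1 < 0 := by
  obtain ⟨M, hM⟩ := hK.isBounded.exists_norm_le
  set a : E4 := -((M + 1) • (EuclideanSpace.single 0 1 + EuclideanSpace.single 1 1)) with ha
  have ha0 : a 0 = -(M + 1) := by simp [ha]
  have ha1 : a 1 = -(M + 1) := by simp [ha]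
  refine ⟨a, fun x hx i => ?_⟩
  have hxi : ‖x i - a‖ ≤ M := (norm_le_pi_norm (fun j => x j - a) i).trans (hM _ hx)
  have h0 : |x i 0 - a 0| ≤ M := by
    simpa [Real.norm_eq_abs] using (PiLp.norm_apply_le (x i - a) 0).trans hxi
  have h1 : |x i 1 - a 1| ≤ M := by
    simpa [Real.norm_eq_abs] using (PiLp.norm_apply_le (x i - a) 1).trans hxi
  rw [ha0] at h0
  rw [ha1] at h1
  exact ⟨by linarith [(abs_le.1 h0).2], by linarith [(abs_le.1 h1).2]⟩

/-- **The degenerate (vacuum) slot of the eighth-turn identity, transported by translations.** Let `S₁` be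
translation invariant on `⁰𝒮` and let the eighth-turn identity hold for the pair `(Rq, R₈)`: for all `m, n`, all
quadrant-supported off-diagonal `G₁` (`m` points), `G₂` (`n` points), `𝔖ₘ₊ₙ(Θ(R₈G₁)* ⊗ R₈G₂) = 𝔖ₘ₊ₙ(ΘG₁* ⊗ RqG₂)`.
Then `𝔖ₘ(R₈⁻¹·F) = 𝔖ₘ(F)` for every compactly supported `F` whose support avoids the coincidence locus. Proof: take
`n = 0`, `G₂ = 1` (the empty tensor) and `G₁ = ΘA*` for the translate `A = F(· - a)` of `F` into the negative
quadrant `{x⁰ < 0, x¹ < 0}` (all `m` points; `a` exists by compactness): `ΘG₁* = A`, `Θ(R₈G₁)* = R₈⁻¹·A`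
(`θ R₈ θ = R₈⁻¹`), so the identity reads `𝔖ₘ(R₈⁻¹·A) = 𝔖ₘ(A)`; finally `R₈⁻¹·A = (R₈⁻¹·F)(· - R₈⁻¹a)` and
translation invariance on `⁰𝒮` remove `a` on both sides. [folklore] -/
theorem apply_linActMulti_symm_eq_of_identity (S₁ : SchwingerFamily E4) (htr : Translations S₁)
    {Rq R₈ : E4 ≃ₗᵢ[ℝ] E4}
    (h0 : R₈ (EuclideanSpace.single 0 1) =
      (Real.sqrt 2 / 2) • EuclideanSpace.single 0 1 + (Real.sqrt 2 / 2) • EuclideanSpace.single 1 1)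
    (h1 : R₈ (EuclideanSpace.single 1 1) =
      -((Real.sqrt 2 / 2) • EuclideanSpace.single 0 1) + (Real.sqrt 2 / 2) • EuclideanSpace.single 1 1)
    (h2 : R₈ (EuclideanSpace.single 2 1) = EuclideanSpace.single 2 1)
    (h3 : R₈ (EuclideanSpace.single 3 1) = EuclideanSpace.single 3 1)
    (hid : ∀ (m n : ℕ) (G₁ : 𝓢((Fin m → E4), ℂ)) (G₂ : 𝓢((Fin n → E4), ℂ)),
      tsupport (G₁ : (Fin m → E4) → ℂ) ⊆ {x | ∀ i, 0 < x i 0 ∧ x i 1 < 0} →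
      tsupport (G₂ : (Fin n → E4) → ℂ) ⊆ {x | ∀ i, 0 < x i 0 ∧ x i 1 < 0} →
      IsOffDiagonal G₁ → IsOffDiagonal G₂ →
      ∀ (H H' : 𝓢((Fin (m + n) → E4), ℂ)),
        IsAppendTensorOf H (osAdjoint (linActMulti R₈ G₁)) (linActMulti R₈ G₂) →
        IsAppendTensorOf H' (osAdjoint G₁) (linActMulti Rq G₂) →
        S₁ (m + n) H = S₁ (m + n) H')
    {m : ℕ} {G : Set (Fin m → E4)} (hGc : G ⊆ (coincidenceLocus m E4)ᶜ)
    (F : 𝓢((Fin m → E4), ℂ)) (hFG : tsupport (F : (Fin m → E4) → ℂ) ⊆ G)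
    (hFc : HasCompactSupport (F : (Fin m → E4) → ℂ)) :
    S₁ m (linActMulti R₈.symm F) = S₁ m F := by
  have hFoff : IsOffDiagonal F := IsOffDiagonal.of_tsupport_subset (hFG.trans hGc)
  -- translate `F` into the negative quadrant
  obtain ⟨a, ha⟩ := exists_translate_neg hFc
  set A : 𝓢((Fin m → E4), ℂ) := translateMulti a F with hA
  have hAsub : tsupport (A : (Fin m → E4) → ℂ) ⊆ {x | (fun i => x i - a) ∈ tsupport (F : (Fin m → E4) → ℂ)} :=
    tsupport_translateMulti_subset a F
  have hAneg : tsupport (A : (Fin m → E4) → ℂ) ⊆ {x | ∀ i, x i 0 < 0 ∧ x i 1 < 0} := fun x hx =>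
    ha x (hAsub hx)
  have hAc : tsupport (A : (Fin m → E4) → ℂ) ⊆ (coincidenceLocus m E4)ᶜ := by
    intro x hx hxc
    obtain ⟨i, j, hij, hxij⟩ := hxc
    exact hGc (hFG (hAsub hx)) ⟨i, j, hij, by simp [hxij]⟩
  -- the vacuum slot of the identity: `G₁ = ΘA*`, `G₂ = 1`
  set G₁ : 𝓢((Fin m → E4), ℂ) := osAdjoint A with hG₁
  set G₂ : 𝓢((Fin 0 → E4), ℂ) := SchwartzMap.constOfSubsingleton 1 with hG₂
  have hG₁sub : tsupport (G₁ : (Fin m → E4) → ℂ) ⊆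
      (fun x => fun i => timeReflection 4 (x (Fin.rev i))) ⁻¹' tsupport (A : (Fin m → E4) → ℂ) :=
    OSReconstructionNoE1.tsupport_osAdjoint_subset A
  have hG₁supp : tsupport (G₁ : (Fin m → E4) → ℂ) ⊆ {x | ∀ i, 0 < x i 0 ∧ x i 1 < 0} := by
    intro x hx i
    have h := hAneg (hG₁sub hx) (Fin.rev i)
    simp only [Fin.rev_rev, (theta_coord (x i)).1, (theta_coord (x i)).2.1] at h
    exact ⟨by linarith [h.1], h.2⟩
  have hG₁off : IsOffDiagonal G₁ := by
    refine IsOffDiagonal.of_tsupport_subset fun x hx hxc => ?_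
    obtain ⟨i, j, hij, hxij⟩ := hxc
    refine hAc (hG₁sub hx) ⟨Fin.rev i, Fin.rev j, fun h => hij (Fin.rev_injective h), ?_⟩
    simp [Fin.rev_rev, hxij]
  have hG₂supp : tsupport (G₂ : (Fin 0 → E4) → ℂ) ⊆ {x | ∀ i, 0 < x i 0 ∧ x i 1 < 0} :=
    fun x _ i => i.elim0
  have hG₂off : IsOffDiagonal G₂ := by
    rintro x ⟨i, -, -, -⟩
    exact i.elim0
  have hH : IsAppendTensorOf (linActMulti R₈.symm A : 𝓢((Fin (m + 0) → E4), ℂ))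
      (osAdjoint (linActMulti R₈ G₁)) (linActMulti R₈ G₂) := by
    intro x
    rw [hG₁, osAdjoint_linActMulti_osAdjoint R₈ h0 h1 h2 h3 sqrt_two_half_sq]
    simp only [hG₂, linActMulti_apply, SchwartzMap.constOfSubsingleton_apply, mul_one]
    rfl
  have hH' : IsAppendTensorOf (n := m) (m := 0) A (osAdjoint G₁) (linActMulti Rq G₂) := by
    intro x
    rw [hG₁, osAdjoint_osAdjoint]
    simp only [hG₂, linActMulti_apply, SchwartzMap.constOfSubsingleton_apply, mul_one]
    rfl
  have key : S₁ m (linActMulti R₈.symm A) = S₁ m A :=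
    hid m 0 G₁ G₂ hG₁supp hG₂supp hG₁off hG₂off _ _ hH hH'
  -- remove the translation on both sides
  have hAoff : IsOffDiagonal A := IsOffDiagonal.of_tsupport_subset hAc
  rw [hA, linActMulti_translateMulti, htr m (R₈.symm a) _ (isOffDiagonal_linActMulti hFoff _),
    htr m a F hFoff] at key
  exact key

end Propagation

open Propagation in
/-- **Stub E of line `quarter-turn-corner-operator` (crux `PencilRigidity.NPointIsotropy`, stmt-QuantumFields-11686):
propagation of the eighth-turn identity to `R_{π/4}`-invariance on `⁰𝒮`**, in the registered text. Since
`Θ(R₈G₁)* ⊗ R₈G₂ = R₈⁻¹·(ΘG₁* ⊗ RqG₂)` (`θ R₈ θ = R₈⁻¹`, `R₈⁻¹Rq = R₈`), the identity hypothesis says that `𝔖` is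
`R₈⁻¹`-invariant on corner-split tests; its slot `n = 0` (`G₂ = 1`, the vacuum vector: `⟨A^{1/2}[G₁], Ω⟩ = ⟨[G₁], Ω⟩`)
already says `𝔖ₘ(R₈⁻¹·A) = 𝔖ₘ(A)` for every off-diagonal `A` supported in the negative quadrant `{x⁰ < 0, x¹ < 0}`
(all `m` points). Translations (`Translations S₁`) move every compactly supported configuration there and commute
with `R₈⁻¹` up to a rotated translation (`Propagation.apply_linActMulti_symm_eq_of_identity`), so
`𝔖ₘ(R₈⁻¹·F) = 𝔖ₘ(F)` for all compactly supported `F` with support off the coincidence locus; the function residual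
`NPointRegular` and the a.e. exhaustion `Mopup.apply_linActMulti_eq_of_generic` (change of variables + dominated
convergence over a conull open set avoiding the coincidence locus) pass to all of `⁰𝒮ₘ`; finally
`𝔖ₘ(F) = 𝔖ₘ(R₈⁻¹·(R₈·F)) = 𝔖ₘ(R₈·F)`. The quarter-turn fed to the hypothesis is `Rq = R₈²`. The OS package,
hypercubic invariance, the eight-frame (un)ordered E2 and the planar spectral cone are not used. [folklore] -/
theorem stub_eighthTurnPropagation :
    open Literature.MathematicalPhysics.QuantumLattice Literature.MathematicalPhysics.AQFT
      Literature.MathematicalPhysics.QuantumFieldTheory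
      Summit.QuantumFields.YangMills.Theorems.CurvatureBoostCovariance.Negative
      Summit.QuantumFields.YangMills.Theorems.NPointIsotropy.Negative in
    ∀ (S₁ : SchwingerFamily E4), OSPackage S₁ → Translations S₁ → Hypercubic S₁ → EightFrameRP S₁ →
      NPointRegular S₁ →
      (∀ (R : E4 ≃ₗᵢ[ℝ] E4) (a b : ℝ), a ^ 2 + b ^ 2 = 1 → (a = 0 ∨ b = 0 ∨ a ^ 2 = b ^ 2) →
        R (EuclideanSpace.single 0 1) = a • EuclideanSpace.single 0 1 + b • EuclideanSpace.single 1 1 →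
        ∀ (N : ℕ) (F : (n : ℕ) → SchwartzMap (Fin n → E4) ℂ),
          (∀ n, N < n → F n = 0) → (∀ n, IsPositiveTimeMulti (F n)) → (∀ n, IsOffDiagonal (F n)) →
          ∀ H : (n m : ℕ) → SchwartzMap (Fin (n + m) → E4) ℂ,
            (∀ n m, IsAppendTensorOf (H n m) (osAdjoint (F n)) (F m)) →
            0 ≤ (∑ n ∈ Finset.range (N + 1), ∑ m ∈ Finset.range (N + 1),
                (S₁ (n + m)).comp (linActMulti R) (H n m)).re ∧
              (∑ n ∈ Finset.range (N + 1), ∑ m ∈ Finset.range (N + 1),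
                (S₁ (n + m)).comp (linActMulti R) (H n m)).im = 0) →
      Summit.QuantumFields.YangMills.Theses.MirrorModularBoosts.PlanarSpectralCone →
      (∀ (Rq R₈ : E4 ≃ₗᵢ[ℝ] E4),
        (Rq (EuclideanSpace.single 0 1) = EuclideanSpace.single 1 1 ∧
          Rq (EuclideanSpace.single 1 1) = -EuclideanSpace.single 0 1 ∧
          Rq (EuclideanSpace.single 2 1) = EuclideanSpace.single 2 1 ∧
          Rq (EuclideanSpace.single 3 1) = EuclideanSpace.single 3 1) →
        (R₈ (EuclideanSpace.single 0 1) =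
            (Real.sqrt 2 / 2) • EuclideanSpace.single 0 1 + (Real.sqrt 2 / 2) • EuclideanSpace.single 1 1 ∧
          R₈ (EuclideanSpace.single 1 1) =
            -((Real.sqrt 2 / 2) • EuclideanSpace.single 0 1) + (Real.sqrt 2 / 2) • EuclideanSpace.single 1 1 ∧
          R₈ (EuclideanSpace.single 2 1) = EuclideanSpace.single 2 1 ∧
          R₈ (EuclideanSpace.single 3 1) = EuclideanSpace.single 3 1) →
        ∀ (m n : ℕ) (G₁ : SchwartzMap (Fin m → E4) ℂ) (G₂ : SchwartzMap (Fin n → E4) ℂ),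
          tsupport (G₁ : (Fin m → E4) → ℂ) ⊆ {x | ∀ i, 0 < x i 0 ∧ x i 1 < 0} →
          tsupport (G₂ : (Fin n → E4) → ℂ) ⊆ {x | ∀ i, 0 < x i 0 ∧ x i 1 < 0} →
          IsOffDiagonal G₁ → IsOffDiagonal G₂ →
          ∀ (H H' : SchwartzMap (Fin (m + n) → E4) ℂ),
            IsAppendTensorOf H (osAdjoint (linActMulti R₈ G₁)) (linActMulti R₈ G₂) →
            IsAppendTensorOf H' (osAdjoint G₁) (linActMulti Rq G₂) →
            S₁ (m + n) H = S₁ (m + n) H') →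
      ∀ R₈ : E4 ≃ₗᵢ[ℝ] E4,
        (R₈ (EuclideanSpace.single 0 1) =
            (Real.sqrt 2 / 2) • EuclideanSpace.single 0 1 + (Real.sqrt 2 / 2) • EuclideanSpace.single 1 1 ∧
          R₈ (EuclideanSpace.single 1 1) =
            -((Real.sqrt 2 / 2) • EuclideanSpace.single 0 1) + (Real.sqrt 2 / 2) • EuclideanSpace.single 1 1 ∧
          R₈ (EuclideanSpace.single 2 1) = EuclideanSpace.single 2 1 ∧
          R₈ (EuclideanSpace.single 3 1) = EuclideanSpace.single 3 1) →
        ∀ (n : ℕ) (F : SchwartzMap (Fin n → E4) ℂ), IsOffDiagonal F → S₁ n (linActMulti R₈ F) = S₁ n F := by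
  intro S₁ _hOS htr _hhyp _h8 hreg _hurp _hcone hid R₈ hR₈ n F hF
  obtain ⟨h0, h1, h2, h3⟩ := hR₈
  have hid' := hid (R₈.trans R₈) R₈ (quarterTurn_trans R₈ h0 h1 h2 h3) ⟨h0, h1, h2, h3⟩
  -- `R₈⁻¹`-invariance on all of `⁰𝒮ₙ` (a.e. exhaustion over a conull open set off the coincidence locus)
  have hsymm : ∀ F' : 𝓢((Fin n → E4), ℂ), IsOffDiagonal F' → S₁ n (linActMulti R₈.symm F') = S₁ n F' := by
    obtain ⟨W, hW⟩ := hreg n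
    obtain ⟨G, hGo, hG0, hGc, -⟩ := ComplexRotationBandlimit.Mopup.exists_generic_set n
    exact ComplexRotationBandlimit.Mopup.apply_linActMulti_eq_of_generic (S₁ n) hW R₈.symm hGo hG0 hGc
      fun F' hF'G hF'c => apply_linActMulti_symm_eq_of_identity S₁ htr h0 h1 h2 h3 hid' hGc F' hF'G hF'c
  have h := hsymm (linActMulti R₈ F) (isOffDiagonal_linActMulti hF R₈)
  rw [linActMulti_symm_linActMulti] at h
  exact h.symm

end Summit.QuantumFields.YangMills.Theorems.NPointIsotropy.QuarterTurnCornerOperator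

end
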